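import Summits.QuantumFields.YangMills.Theorems.BalabanUVNodesN21LowCentreEndAtSUNBlockChartJacobianEnd
import Summits.QuantumFields.YangMills.Theorems.BalabanUVNodesN21LowCentreEndAtSUNBlockChartAnalytic

/-!
# N21 (NE7c) · THE [LF-II] §1-LETTERS END ON THE EXPONENTIAL `SU(N)` BLOCK CHART, VIII: the per-fibre CHART PACKAGE of dag-n21-w2's keyed
# knit (`…ChartKeyed` ∕ `…ChartKeyedGuarded`: `∃ (S, c, R, U, A, f, D), …` — window factorisation, cut, reading identity, density
# presentation, cut-law (M1), `D ≤ D_K`) PRODUCED IN ONE STEP from the dressed presentation and the [LF-II] §1 chart binders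

Width seat pub-ymgap-dag-n21-w1 (g2; director-ym №197 ∕ HUMAN RULING D-0149), node N21 = NE7c (NOT PRINTED in [Bałaban 1983–89], NOT
proved), lane K3⁷ `SpineGivenEndpointR13SepCoPH` (stmt-QuantumFields-20544, `--kind proof --supports … --as helper`).  File 17 of the seat's
item-1 chain; composes BY NAME file 12 ★ `cutChartLawAC_of_sect1Letters_dressed` (p608182) and file 11 §3 `hdens_of_dressedPresentation`
(p606884) into the literal ∃-shape consumed per fibre by dag-n21-w2 g2's `N21ChartJunctionKeyed.shellWeightBound_crOfRecord₁₃At_shellSplit_of_chartLaws`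
(p605800) — generic in the block `b`, the statistic `u` and the exterior `x`, so the knit instantiates it at `inputBlock a`, `cubeStat a`, `1`.
THEOREMS ONLY: 0 `def`, 0 `sorry`; count-neutral.

WHAT IS PROVED ([bookkeeping]).
* ★ `chartPackage_of_sect1Letters_dressed` — from: `0 < S < π`, centre `c`, measurable block weight `R` with the window factorisation `hlaw`
  (as a HYPOTHESIS on whatever law `μ` the consumer names — stated for an arbitrary `μ = (blockLaw b).withDensity (windowSU b c S · R)`
  identity so that both the block and the term fibre laws fit), the dressed presentation `hR` on the window, the reading identity `hread`
  on the window for a block statistic `v`, file 12 ★'s chart binders, and `3(#b·d_N+1)(1+Q)∕(κ₀(1−ρ)) ≤ D_K` ⇒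
  `∃ S' c' R' U' A f D, 0 ≤ S' ∧ S' ≤ π ∧ Measurable R' ∧ μ = (blockLaw b).withDensity (windowSU b c' S' · R') ∧ MeasurableSet A ∧
  (∀ z ∈ closedBall 0 S', v (expFibreChartSU b c' z) = U' z) ∧ (chart density =ᵐ A.indicator f) ∧
  SlotAntiConcentration ((vol.withDensity f)|A) U' θ ρ D ∧ D ≤ D_K` — the package, witnessed by
  `(S, c, R, U, {U<θ} ∩ C, 𝟙_{K₀ ∩ B̄_S} e^{−(A + Ψ − #b log κ_N)}, 3(#b·d_N+1)(1+Q)∕(κ₀(1−ρ)))`.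

HONEST FRAMING.  ∃-introduction over landed theorems, nothing retyped; the located letters (`hlaw`, `hR`, the rows' identification, the
statistic's binders) remain the consumer's HYPOTHESES; nothing of Bałaban's asserted; NE7c NOT PRINTED ∕ NOT proved; N21 NOT discharged;
K3⁷ NOT claimed; counts unmoved (typed 28∕28 · discharged 5∕27); never a count claim; one finite 𝕋⁴ at fixed ε — R4 would close only the
conditional finite-𝕋⁴ rung `BalabanLadder.UV`, NOT the Yang–Mills mass gap (Clay); nothing about ℝ⁴ ∕ OS.

v1.1 (APPEND-ONLY; v1 declaration byte-identical): ★ `chartPackage_of_sect1Letters_analyticLocal` — the same ∃-package with the convexity binder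
`hA` REPLACED by the analytic-local letters (matrix quadratic member + (1.9) on all vectors, linear member, `Φ` with a sup bound on the
`r`-balls, `0 < r`, clause `4·d·(100M)^{d+1}·S₂ ≤ γ₀·r²`) through `…Analytic` v1.1 ★ `cutChartLawAC_of_sect1Letters_analyticLocal`
(p614339; dag-n21-w3 g4 ★★′-loc inside).

v1.2 (DOCSTRING-ONLY edition, dag-n21-w1 g4, on ref-O g9 READ-246's two NITs; both declarations byte-identical): (i) the paragraphs above the
v1.1 note describe v1's ★ `chartPackage_of_sect1Letters_dressed` only — the v1.1 ★ takes the analytic-local letter list instead of `hA`; (ii) in the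
v1.1 ★ the (1.9) row `h19` is asked on ALL chart vectors `w` (v1: on `w ∈ K₀`) — a STRENGTHENING of the hypothesis, inherited verbatim from
`…Analytic` v1.1 ★ `cutChartLawAC_of_sect1Letters_analyticLocal` (p614339), recorded here as such; the seat's later file 20 `…PackageCoercive`
(p621358) discharges `h19` from the (1.7) row altogether.
-/

set_option autoImplicit false

noncomputable section

open MeasureTheory Set Function Finset Metric
open scoped ENNReal BigOperators Matrix

namespace Summit.QuantumFields.YangMills.Theorems.N21LowCentreEndAtSUNBlockChartPackage

open Literature.MathematicalPhysics.QuantumFieldTheory.Balaban1983to89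
open Literature.MathematicalPhysics.QuantumFieldTheory.Balaban1983to89.T4Continuum
open Literature.MathematicalPhysics.QuantumFieldTheory.Balaban1983to89.Node00 hiding dimSU
open Literature.MathematicalPhysics.QuantumFieldTheory.Balaban1983to89.T4ShellMeasure (SlotAntiConcentration)
open Literature.MathematicalPhysics.QuantumFieldTheory.Balaban1983to89.T4ShellMeasureDet (blockLaw)
open Literature.MathematicalPhysics.QuantumFieldTheory.Balaban1983to89.B16Sect1Wilson (Ineq16 Ineq19)
open Summit.QuantumFields.BalabanUV.T4Continuum
open Summit.QuantumFields.BalabanUV.T4Continuum.ShellMeasureExpChartSUN (SUN ChartSU BlockChartSU dimSU expFibreChartSU chartWeightSU)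
open Summit.QuantumFields.BalabanUV.T4Continuum.ShellMeasureScalingSUN (windowSU)
open Summit.QuantumFields.BalabanUV.T4Continuum.ShellMeasureExpJacobianSUN (expJacWeightSU)
open Summit.QuantumFields.BalabanUV.T4Continuum.ShellMeasureExpHaarAreaSUN (kappaSU)
open Summit.QuantumFields.BalabanUV.T4Continuum.ShellMeasureExpDuhamelSUN (duhT)
open Summit.QuantumFields.YangMills.Theorems.N21LowCentreEndAtSUNBlockChartJacobian (hdens_of_dressedPresentation)
open Summit.QuantumFields.YangMills.Theorems.N21LowCentreEndAtSUNBlockChartJacobianEnd (cutChartLawAC_of_sect1Letters_dressed)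
open Summit.QuantumFields.YangMills.Theorems.N21LowCentreEndAtSUNBlockChartAnalytic (cutChartLawAC_of_sect1Letters_analyticLocal)

variable {N : ℕ} [NeZero N] {P : Params} {j : ℕ}

/-- ★ **THE PER-FIBRE CHART PACKAGE OF dag-n21-w2's KEYED KNIT, FROM THE DRESSED PRESENTATION AND THE [LF-II] §1 CHART BINDERS.**
For ANY law `μ` on the block `↥b → SU(N)` with the window factorisation `μ = (blockLaw b).withDensity (windowSU b c S · R)` (the block
fibre law of record or one term's), ANY block statistic `v` read in the chart as `U` on the window, the dressed presentation `hR` on the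
window, file 12 ★'s binders (`2 ≤ N`, `b` nonempty, `0 < S < π`, kept convex cuts `K₀ ∋ 0`, convex `A` with the (1.2) expansion and the
rows `Ineq19`∕`Ineq16`, `|Vt| ≤ W_V`, statistic binders, odds, the clause with `W_J`), and `3(#b·d_N+1)(1+Q)∕(κ₀(1−ρ)) ≤ D_K` ⇒ the
∃-package `(S', c', R', U', A, f, D)` in the LITERAL conjunct order of `N21ChartJunctionKeyed.shellWeightBound_crOfRecord₁₃At_shellSplit_of_chartLaws`.
[bookkeeping] -/
theorem chartPackage_of_sect1Letters_dressed (hN : 2 ≤ N) (b : Finset (PBond P j)) (hb : b.Nonempty)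
    (μ : Measure (↥b → SU N)) {S : ℝ} (hS : 0 < S) (hSπ : S < Real.pi) (c : GaugeField P j (SU N))
    {R : (↥b → SU N) → ℝ≥0∞} (hRm : Measurable R)
    (hlaw : μ = (blockLaw b).withDensity fun y => windowSU b c S y * R y)
    (v : (↥b → SU N) → ℝ)
    (K₀ : Set (BlockChartSU N b)) (A Qf lin Vt : BlockChartSU N b → ℝ)
    (hAm : Measurable fun z : BlockChartSU N b => K₀.indicator (fun w => ENNReal.ofReal (Real.exp (-A w))) z)
    {U : BlockChartSU N b → ℝ} (hUm : Measurable U)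
    {C Env : Set (BlockChartSU N b)} (hC : MeasurableSet C) (hEnv : MeasurableSet Env)
    {θ ρ σ κ₀ Q L γ₀ M B₃ M₀ A₀ p₀g Rk WV DK : ℝ} {d : ℕ}
    (hθ : 0 < θ) (hρ0 : 0 < ρ) (hρ1 : ρ < 1) (hρσ : ρ + σ ≤ 1) (hκ : 0 < κ₀) (hQ0 : 0 ≤ Q) (hL : 0 < L)
    (hd : 1 ≤ d) (hM : 0 < M) (hγ₀ : 0 < γ₀)
    (hW : 0 ≤ 3 * B₃ * M₀ * A₀ ^ 2 * p₀g ^ 2 * Real.exp (-Rk) * (100 * M) ^ 4 + WV)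
    (hK₀ : Convex ℝ K₀) (hA : ConvexOn ℝ K₀ A) (h0K₀ : (0 : BlockChartSU N b) ∈ K₀)
    (hexp : ∀ w ∈ K₀, A w = A 0 + 1 / 2 * Qf w + lin w + Vt w)
    (h19 : ∀ w ∈ K₀, Ineq19 (Qf w) (∑ i, ‖w i‖ ^ 2) γ₀ d M)
    (h16 : ∀ w ∈ K₀, Ineq16 (lin w) B₃ M₀ A₀ p₀g Rk M)
    (hV : ∀ w ∈ K₀, |Vt w| ≤ WV)
    (hR : ∀ z ∈ closedBall (0 : BlockChartSU N b) S, R (expFibreChartSU b c z) =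
      ({z | U z < θ} ∩ C).indicator (fun z' => K₀.indicator (fun w => ENNReal.ofReal (Real.exp (-A w))) z') z)
    (hread : ∀ z ∈ closedBall (0 : BlockChartSU N b) S, v (expFibreChartSU b c z) = U z)
    (hUL : ∀ z z' : BlockChartSU N b, U z - U z' ≤ L * ‖z - z'‖)
    (hUc : U 0 ≤ σ * θ)
    (hclause : 16 * (3 * B₃ * M₀ * A₀ ^ 2 * p₀g ^ 2 * Real.exp (-Rk) * (100 * M) ^ 4 +
        (WV + b.card * ((N * N : ℕ) * (-2 * Real.log (Real.sinc S))))) * d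
      * (100 * M) ^ (d + 1) * (dimSU N * L ^ 2) ≤ γ₀ * (θ * (1 - ρ - σ)) ^ 2)
    (henv : ∀ l ∈ Icc (1 - 1 / ((b.card : ℝ) * dimSU N + 1)) 1, ∀ z : BlockChartSU N b,
      θ * (1 - ρ) ≤ U z → U z < θ → z ∈ C → l • z ∈ Env)
    (hRT : ∀ z : BlockChartSU N b, θ * (1 - ρ) ≤ U z → U z < θ → z ∈ C → ∀ s' : ℝ, 1 ≤ s' →
      θ * (1 - ρ) ≤ U (s' • z) → U (s' • z) < θ → s' • z ∈ C → U z + κ₀ * (θ * (1 - ρ)) * (s' - 1) ≤ U (s' • z))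
    (hQ : ((volume : Measure (BlockChartSU N b)).withDensity fun z =>
        chartWeightSU b S (expJacWeightSU (kappaSU N)) z * K₀.indicator (fun w => ENNReal.ofReal (Real.exp (-A w))) z)
          (Env \ ({z | U z < θ} ∩ C))
      ≤ ENNReal.ofReal Q * ((volume : Measure (BlockChartSU N b)).withDensity fun z =>
        chartWeightSU b S (expJacWeightSU (kappaSU N)) z * K₀.indicator (fun w => ENNReal.ofReal (Real.exp (-A w))) z)
          ({z | U z < θ} ∩ C))
    (hD : 3 * ((b.card : ℝ) * dimSU N + 1) * (1 + Q) / (κ₀ * (1 - ρ)) ≤ DK) :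
    ∃ (S' : ℝ) (c' : GaugeField P j (SU N)) (R' : (↥b → SU N) → ℝ≥0∞) (U' : BlockChartSU N b → ℝ)
      (A' : Set (BlockChartSU N b)) (f : BlockChartSU N b → ℝ≥0∞) (D : ℝ),
      0 ≤ S' ∧ S' ≤ Real.pi ∧ Measurable R' ∧
      μ = (blockLaw b).withDensity (fun y => windowSU b c' S' y * R' y) ∧
      MeasurableSet A' ∧
      (∀ z ∈ closedBall (0 : BlockChartSU N b) S', v (expFibreChartSU b c' z) = U' z) ∧
      ((fun z : BlockChartSU N b => chartWeightSU b S' (expJacWeightSU (kappaSU N)) z * R' (expFibreChartSU b c' z))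
        =ᵐ[volume] A'.indicator f) ∧
      SlotAntiConcentration (((volume : Measure (BlockChartSU N b)).withDensity f).restrict A') U' θ ρ D ∧
      D ≤ DK := by
  refine ⟨S, c, R, U, {z | U z < θ} ∩ C,
    fun z => (K₀ ∩ closedBall (0 : BlockChartSU N b) S).indicator
      (fun w => ENNReal.ofReal (Real.exp (-(A w +
        (∑ i, -Real.log (LinearMap.det (duhT (w i) : ChartSU N →ₗ[ℝ] ChartSU N))) -
          b.card * Real.log (kappaSU N).toReal)))) z,
    3 * ((b.card : ℝ) * dimSU N + 1) * (1 + Q) / (κ₀ * (1 - ρ)),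
    hS.le, hSπ.le, hRm, hlaw, (measurableSet_lt hUm measurable_const).inter hC, hread,
    hdens_of_dressedPresentation (N := N) b hSπ.le c R U C K₀ A θ hR, ?_, hD⟩
  exact cutChartLawAC_of_sect1Letters_dressed hN b hb hS hSπ K₀ A Qf lin Vt hAm hUm hC hEnv hθ hρ0 hρ1 hρσ hκ hQ0 hL hd hM hγ₀
    hW hK₀ hA h0K₀ hexp h19 h16 hV hUL hUc hclause henv hRT hQ

/-! ## §2 (v1.1)  The package at the ANALYTIC-LOCAL letter list -/

/-- ★ (v1.1) **THE SAME ∃-PACKAGE WITH THE CONVEXITY OF THE DRESSED EXPONENT DISCHARGED** (`…Analytic` v1.1 ★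
`cutChartLawAC_of_sect1Letters_analyticLocal`, dag-n21-w3 g4 ★★′-loc inside): displayed instead of `hA` — the matrix quadratic member with
(1.9) on all chart vectors, the linear member `ℓ`, the analyticity letter (`Φ`, `0 < r`, sup `S₂` on the `r`-balls about the real points of
`K₀`), and the convexity clause `4·d·(100M)^{d+1}·S₂ ≤ γ₀·r²`. [bookkeeping] -/
theorem chartPackage_of_sect1Letters_analyticLocal (hN : 2 ≤ N) (b : Finset (PBond P j)) (hb : b.Nonempty)
    (μ : Measure (↥b → SU N)) {S : ℝ} (hS : 0 < S) (hSπ : S < Real.pi) (c : GaugeField P j (SU N))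
    {R : (↥b → SU N) → ℝ≥0∞} (hRm : Measurable R)
    (hlaw : μ = (blockLaw b).withDensity fun y => windowSU b c S y * R y)
    (v : (↥b → SU N) → ℝ)
    (K₀ : Set (BlockChartSU N b)) (A Qf lin Vt : BlockChartSU N b → ℝ)
    (hAm : Measurable fun z : BlockChartSU N b => K₀.indicator (fun w => ENNReal.ofReal (Real.exp (-A w))) z)
    {U : BlockChartSU N b → ℝ} (hUm : Measurable U)
    {C Env : Set (BlockChartSU N b)} (hC : MeasurableSet C) (hEnv : MeasurableSet Env)
    {θ ρ σ κ₀ Q L γ₀ M B₃ M₀ A₀ p₀g Rk WV DK r S₂ : ℝ} {d : ℕ}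
    (hθ : 0 < θ) (hρ0 : 0 < ρ) (hρ1 : ρ < 1) (hρσ : ρ + σ ≤ 1) (hκ : 0 < κ₀) (hQ0 : 0 ≤ Q) (hL : 0 < L)
    (hd : 1 ≤ d) (hM : 0 < M) (hγ₀ : 0 < γ₀) (hr : 0 < r)
    (hW : 0 ≤ 3 * B₃ * M₀ * A₀ ^ 2 * p₀g ^ 2 * Real.exp (-Rk) * (100 * M) ^ 4 + WV)
    (hK₀ : Convex ℝ K₀) (h0K₀ : (0 : BlockChartSU N b) ∈ K₀)
    (hexp : ∀ w ∈ K₀, A w = A 0 + 1 / 2 * Qf w + lin w + Vt w)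
    (Mq : Matrix (↥b × Fin (dimSU N)) (↥b × Fin (dimSU N)) ℝ)
    (hQf : ∀ w, Qf w = (fun q : ↥b × Fin (dimSU N) => w q.1 q.2) ⬝ᵥ (Mq *ᵥ fun q => w q.1 q.2))
    (h19 : ∀ w : BlockChartSU N b, Ineq19 (Qf w) (∑ i, ‖w i‖ ^ 2) γ₀ d M)
    (ℓ : BlockChartSU N b →ₗ[ℝ] ℝ) (hlin : ∀ w, lin w = ℓ w)
    (h16 : ∀ w ∈ K₀, Ineq16 (lin w) B₃ M₀ A₀ p₀g Rk M)
    (hV : ∀ w ∈ K₀, |Vt w| ≤ WV)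
    (Φ : (↥b × Fin (dimSU N) → ℂ) → ℂ)
    (hVt : ∀ x ∈ K₀, Vt x = (Φ fun q => ((x q.1 q.2 : ℝ) : ℂ)).re)
    (hΦd : ∀ x ∈ K₀, DifferentiableOn ℂ Φ (ball (fun q => ((x q.1 q.2 : ℝ) : ℂ)) r))
    (hΦS : ∀ x ∈ K₀, ∀ u ∈ ball (fun q : ↥b × Fin (dimSU N) => ((x q.1 q.2 : ℝ) : ℂ)) r, ‖Φ u‖ ≤ S₂)
    (hclause₂ : 4 * d * (100 * M) ^ (d + 1) * S₂ ≤ γ₀ * r ^ 2)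
    (hR : ∀ z ∈ closedBall (0 : BlockChartSU N b) S, R (expFibreChartSU b c z) =
      ({z | U z < θ} ∩ C).indicator (fun z' => K₀.indicator (fun w => ENNReal.ofReal (Real.exp (-A w))) z') z)
    (hread : ∀ z ∈ closedBall (0 : BlockChartSU N b) S, v (expFibreChartSU b c z) = U z)
    (hUL : ∀ z z' : BlockChartSU N b, U z - U z' ≤ L * ‖z - z'‖)
    (hUc : U 0 ≤ σ * θ)
    (hclause : 16 * (3 * B₃ * M₀ * A₀ ^ 2 * p₀g ^ 2 * Real.exp (-Rk) * (100 * M) ^ 4 +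
        (WV + b.card * ((N * N : ℕ) * (-2 * Real.log (Real.sinc S))))) * d
      * (100 * M) ^ (d + 1) * (dimSU N * L ^ 2) ≤ γ₀ * (θ * (1 - ρ - σ)) ^ 2)
    (henv : ∀ l ∈ Icc (1 - 1 / ((b.card : ℝ) * dimSU N + 1)) 1, ∀ z : BlockChartSU N b,
      θ * (1 - ρ) ≤ U z → U z < θ → z ∈ C → l • z ∈ Env)
    (hRT : ∀ z : BlockChartSU N b, θ * (1 - ρ) ≤ U z → U z < θ → z ∈ C → ∀ s' : ℝ, 1 ≤ s' →
      θ * (1 - ρ) ≤ U (s' • z) → U (s' • z) < θ → s' • z ∈ C → U z + κ₀ * (θ * (1 - ρ)) * (s' - 1) ≤ U (s' • z))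
    (hQ : ((volume : Measure (BlockChartSU N b)).withDensity fun z =>
        chartWeightSU b S (expJacWeightSU (kappaSU N)) z * K₀.indicator (fun w => ENNReal.ofReal (Real.exp (-A w))) z)
          (Env \ ({z | U z < θ} ∩ C))
      ≤ ENNReal.ofReal Q * ((volume : Measure (BlockChartSU N b)).withDensity fun z =>
        chartWeightSU b S (expJacWeightSU (kappaSU N)) z * K₀.indicator (fun w => ENNReal.ofReal (Real.exp (-A w))) z)
          ({z | U z < θ} ∩ C))
    (hD : 3 * ((b.card : ℝ) * dimSU N + 1) * (1 + Q) / (κ₀ * (1 - ρ)) ≤ DK) :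
    ∃ (S' : ℝ) (c' : GaugeField P j (SU N)) (R' : (↥b → SU N) → ℝ≥0∞) (U' : BlockChartSU N b → ℝ)
      (A' : Set (BlockChartSU N b)) (f : BlockChartSU N b → ℝ≥0∞) (D : ℝ),
      0 ≤ S' ∧ S' ≤ Real.pi ∧ Measurable R' ∧
      μ = (blockLaw b).withDensity (fun y => windowSU b c' S' y * R' y) ∧
      MeasurableSet A' ∧
      (∀ z ∈ closedBall (0 : BlockChartSU N b) S', v (expFibreChartSU b c' z) = U' z) ∧
      ((fun z : BlockChartSU N b => chartWeightSU b S' (expJacWeightSU (kappaSU N)) z * R' (expFibreChartSU b c' z))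
        =ᵐ[volume] A'.indicator f) ∧
      SlotAntiConcentration (((volume : Measure (BlockChartSU N b)).withDensity f).restrict A') U' θ ρ D ∧
      D ≤ DK := by
  refine ⟨S, c, R, U, {z | U z < θ} ∩ C,
    fun z => (K₀ ∩ closedBall (0 : BlockChartSU N b) S).indicator
      (fun w => ENNReal.ofReal (Real.exp (-(A w +
        (∑ i, -Real.log (LinearMap.det (duhT (w i) : ChartSU N →ₗ[ℝ] ChartSU N))) -
          b.card * Real.log (kappaSU N).toReal)))) z,
    3 * ((b.card : ℝ) * dimSU N + 1) * (1 + Q) / (κ₀ * (1 - ρ)),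
    hS.le, hSπ.le, hRm, hlaw, (measurableSet_lt hUm measurable_const).inter hC, hread,
    hdens_of_dressedPresentation (N := N) b hSπ.le c R U C K₀ A θ hR, ?_, hD⟩
  exact cutChartLawAC_of_sect1Letters_analyticLocal hN b hb hS hSπ K₀ A Qf lin Vt hAm hUm hC hEnv hθ hρ0 hρ1 hρσ hκ hQ0 hL hd hM
    hγ₀ hr hW hK₀ h0K₀ hexp Mq hQf h19 ℓ hlin h16 hV Φ hVt hΦd hΦS hclause₂ hUL hUc hclause henv hRT hQ

end Summit.QuantumFields.YangMills.Theorems.N21LowCentreEndAtSUNBlockChartPackage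

end
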